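import Literature.NumberTheory.GaloisCohomology.Howard2004.DualityDatumTateDualBridge
import Literature.NumberTheory.GaloisCohomology.Howard2004.TransportUnramified
import Literature.NumberTheory.GaloisCohomology.PoitouTate
import Literature.NumberTheory.GaloisRepresentations.GaloisCohomologyScalarAction
import HarnessLib

/-!
# Howard 2004, §1.5: reciprocity + H.4 ⇒ isotropy of the relaxed Selmer group at an inert prime
# («`⟨c_ℓ, d_ℓ̄⟩_ℓ = ∑_v ⟨c_v, d_v̄⟩_v = 0`», Lemma 1.5.3 (b) and Lemma 1.5.6 at `m = ℓ`)

Topic `NumberTheory/GaloisCohomology/Howard2004`. THEOREMS ONLY: no definition, no named fact, no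
instance, no notation, no `sorry`. Cell `pub/bsd-print-x9`, print leaf G87
`Literature.NumberTheory.GaloisCohomology.Howard2004.thm161_dvrKolyvaginBound` (Howard Thm. 1.6.1);
seat `bsd-line-x10b-p1-w5` g7 (the Galois input «isotropy» of Lemma 1.5.3, sequel to
`Algebra/Module/IsotropicLineParity.lean` and `ResidualTauCohomologyProofs.lean`).

SOURCE. B. Howard, *The Heegner point Kolyvagin system*, Compositio Math. **140** (2004) =
arXiv:1202.6340. Lemma 1.5.3, proof of (b) (p. 10 L27–33): «If `c ∈ H¹_{𝓕^ℓ(n)}(K, T̄)^±` then the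
local image of `c` at `ℓ` is self-orthogonal under the local pairing. Indeed, the reciprocity law of
class field theory and the isotropy of the local conditions `𝓕(n)` (by H.4) imply
`⟨c_ℓ, c_ℓ⟩_ℓ = ∑_v ⟨c_v, c_v̄⟩_v = 0` where the sum is over all places of `K`.» Lemma 1.5.6 (p. 10
L86–93): «The local condition `𝓕^m(n)` is maximal isotropic away from `m` under the local Tate
pairing, and the reciprocity law of class field theory implies that for any `c, d ∈ H¹_{𝓕^m(n)}(K, T)`,
`∑_{λ∣m} ⟨c_λ, d_λ⟩_λ = ∑_{all v} ⟨c_v, d_v̄⟩_v = 0`, which shows that `A ⊂ A^⟂`.» Here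
`⟨x, y⟩_v : H¹(K_v, T) × H¹(K_v̄, T) → R` is the pairing of H.4 (`(x, y) ↦ inv_v(x ∪_e y^τ)`,
§1.3 p. 7 L78–82), `ℓ` is a degree-two (inert) prime, so `ℓ̄ = ℓ`.

WHAT IS PROVED, for a GENERAL duality datum `D : DualityDatum p cd ρ R` (Howard's H.4 data on ANY
level `T` over ANY level ring `R`; the residual `T̄` is the case of a residual datum):
* §1 (the conjugation datum) `ConjugationDatum.sigma_sigma` / `smul_smul_place` (`σ² = 1` on `K`
  and on finite places, from `τ² = 1`); **`ConjugationDatum.localization_pullback_conj`**: the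
  localization at `v` of the GLOBAL twist `τ^* d ∈ H¹(K, Tw T)` (`galoisCohomology.pullback ρ cd.conj`)
  is Howard's local transport of the localization at `v̄ = σ v`:
  `loc_v (τ^* d) = transport_v (loc_{σ v} d)` (the inner correction `δ_v` is a coboundary) — the
  `θ`-free twin of `ResidualTau.localization_semilinearH`.
* §2 (reciprocity) **`DualityDatum.inv_cohomologyMap_localCup_transportH1_eq_zero`**: let
  `inv : LocalInvariants K (p^k)` satisfy `SumLocalTermEqZero` (reciprocity for the local Tate
  pairings; a THEOREM of the tree for the canonical family, `poitouTate_selmerStructure_duality_conj_holds`),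
  `T` finite with `p^k T = 0`, `(λ, exp)` a character/trivialisation pair as in
  `DualityDatumTateDualBridge` (reading `R(1) → μ_{p^k}`), `q` an INERT finite place (`σ q = q`),
  `𝓕` a Selmer structure SELF-ORTHOGONAL under `D` at every finite `v ≠ q` (H.4,
  `DualityDatum.IsSelfOrthogonalAt`), and `c, d ∈ H¹(K, T)` with `loc_v c, loc_v d ∈ 𝓕_v` at every
  finite `v ≠ q` (classes of the structure RELAXED at `q`) and `loc_w c = 0` at the infinite places
  (automatic for `K` imaginary quadratic). Then the local term at `q` vanishes:
  `inv_q (H²(exp ∘ λ) (loc_q c ∪_e transport_q (loc_{σ q} d))) = 0` — «`⟨c_q, d_q̄⟩_q = 0`» read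
  through `(λ, exp)`; with `inv_q` injective (`IsPerfect`), `H²(exp ∘ λ)(loc_q c ∪_e transport_q(loc_{σq} d)) = 0`
  (`cohomologyMap_localCup_transportH1_eq_zero`); Selmer-group form `…_of_mem_selmerGroup`.
  PROOF = Howard's: apply `SumLocalTermEqZero` at `S = {q}` to `x = c` and the global class
  `y = Θ_*(τ^* d) ∈ H¹(K, T^∨(1))` (`Θ = D.toTateDual`, `τ^* = pullback cd.conj`); at a finite `v ≠ q`
  the local term is `inv_v(H²(exp λ)(loc_v c ∪_e transport_v(loc_{σv} d)))` by §1, `localization_map_one`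
  and the bridge `cohomologyMap_localCup_eq_localTatePairing`, and `loc_v c ∪_e transport_v(loc_{σ v} d) = 0`
  by H.4 at `v` since `σ v ≠ q`; at the infinite places `loc_w c = 0`.

NOT HERE: the deduction «`H²(exp ∘ λ)(z) = 0` for all twists `⇒ z = 0`» (a property of the reading
pair, cf. `DualityDatumLocalCup*Reading*Proofs` for the Eisenstein levels), the opposite inclusion
`A^⟂ ⊆ A` / the length count `len A = 2k·ν` (global duality), eigenlines, the residual duality datum;
`thm161_dvrKolyvaginBound` is NOT proved; no summit statement is proved; the Birch–Swinnerton-Dyer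
conjecture is not proved by any of this.
References: [Howard2004HeegnerKolyvagin] Lemma 1.5.3 (b), Lemma 1.5.6, §1.3 H.4; [MilneADT2006] I
Thm. 4.10 (reciprocity `∑_v inv_v = 0`); [SerreGaloisCohomology1997] I §2.4; [SerreLocalFields1979] VII §5 Prop. 3.
-/

set_option autoImplicit false

noncomputable section

open Function NumberField IsDedekindDomain Field CategoryTheory
open scoped NumberField

namespace Literature.NumberTheory.GaloisCohomology.Howard2004

open Literature.NumberTheory.GaloisRepresentations
open Literature.NumberTheory.GaloisRepresentations.DiscreteGaloisModule
open Literature.NumberTheory.EllipticCurves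


variable {K : Type} [Field K] [NumberField K] {M : Type} [AddCommGroup M] [TopologicalSpace M]
  [DiscreteTopology M]

/-! ## §1 The conjugation datum: `σ² = 1`, and `loc_v ∘ τ^* = transport_v ∘ loc_{σ v}` -/

namespace ConjugationDatum

/-- `σ² = 1` on `K`: `τ` is an involution of `K̄` lifting `σ`. [cite: Howard2004HeegnerKolyvagin, §1.3 (arXiv p. 7 L33–41: «`τ` a fixed complex conjugation»)] -/
theorem sigma_sigma (cd : ConjugationDatum K) (x : K) : cd.σ (cd.σ x) = x := by
  apply (algebraMap K (AlgebraicClosure K)).injective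
  rw [← cd.isLift, ← cd.isLift, cd.involutive]

/-- `σ • (σ • v) = v` on finite places. [cite: Howard2004HeegnerKolyvagin, §1.3 (arXiv p. 7 L44: «`v̄ = v^τ`»)] -/
theorem smul_smul_place (cd : ConjugationDatum K) (v : HeightOneSpectrum (𝓞 K)) :
    cd.σ • (cd.σ • v) = v := by
  have hσ : cd.σ * cd.σ = 1 := AlgEquiv.ext fun x => cd.sigma_sigma x
  rw [smul_smul, hσ, one_smul]

/-- At an inert place `q` (`σ q = q`), every other finite place `v ≠ q` has `σ v ≠ q`.
[cite: Howard2004HeegnerKolyvagin, §1.2 (arXiv p. 6 L54–56: degree-two primes)] -/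
theorem smul_ne_of_ne (cd : ConjugationDatum K) {q v : HeightOneSpectrum (𝓞 K)} (hq : cd.σ • q = q)
    (hv : v ≠ q) : cd.σ • v ≠ q := by
  intro h
  apply hv
  rw [← cd.smul_smul_place v, h, hq]

/-- Two continuous crossed homomorphisms that differ by a coboundary have the same class. [folklore] -/
private theorem oneCocycleClass_eq_of_forall_sub_eq {G : Type} [Group G] [TopologicalSpace G]
    [IsTopologicalGroup G] {Y : TopRep ℤ G} (a b : contOneCocycles Y) (m : Y)
    (h : ∀ g, a.1 g - b.1 g = Y.ρ g m - m) : oneCocycleClass Y a = oneCocycleClass Y b := by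
  rw [← sub_eq_zero, ← oneCocycleClass_sub, oneCocycleClass_eq_zero_iff]
  exact ⟨m, fun g => by rw [Submodule.coe_sub, ContinuousMap.sub_apply]; exact h g⟩

omit [NumberField K] in
/-- Cocycle identity `f(δ z δ⁻¹) = f(δ) + δ·f(z) − (δ z δ⁻¹)·f(δ)`. [folklore] -/
private theorem cocycle_apply_conj {ρ : DiscreteGaloisModule K M} (f : contOneCocycles ρ.toTopRep)
    (δ z : absoluteGaloisGroup K) :
    f.1 (δ * z * δ⁻¹) = f.1 δ + ρ δ (f.1 z) - ρ (δ * z * δ⁻¹) (f.1 δ) := by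
  have e1 : f.1 (δ * z * δ⁻¹ * δ) = f.1 (δ * z * δ⁻¹) + ρ (δ * z * δ⁻¹) (f.1 δ) := by
    rw [(mem_contOneCocycles_iff f.1).mp f.2 (δ * z * δ⁻¹) δ, ContinuousRep.toTopRep_ρ_apply]
  have e2 : f.1 (δ * z * δ⁻¹ * δ) = f.1 δ + ρ δ (f.1 z) := by
    rw [inv_mul_cancel_right, (mem_contOneCocycles_iff f.1).mp f.2 δ z,
      ContinuousRep.toTopRep_ρ_apply]
  rw [e2] at e1
  exact eq_sub_of_add_eq e1.symm

/-- **`loc_v (τ^* d) = transport_v (loc_{σ v} d)`**: the localization at a finite place `v` of the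
global twist `τ^* d ∈ H¹(K, Tw T)` (pull-back of `d ∈ H¹(K, T)` along `g ↦ g^τ`, identity on
coefficients) is Howard's local transport `H¹(K_{σ v}, T) → H¹(K_v, Tw T)` of `loc_{σ v} d`; the inner
correction `δ_v` of the datum (`(res_v g)^τ = δ_v · res_{σv}(φ_v g) · δ_v⁻¹`) contributes the
coboundary of `d(δ_v)`. So the family `(transport_v (loc_{v̄} d))_v` of H.4 IS the localization of one
global class. [cite: Howard2004HeegnerKolyvagin, §1.3 (arXiv p. 7 L44–48: «conjugation by `τ` induces `H^i(K_v̄, T) ≅ H^i(K_v, Tw(T))`»)] [cite: SerreLocalFields1979, VII §5 Prop. 3] -/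
theorem localization_pullback_conj (cd : ConjugationDatum K) (ρ : DiscreteGaloisModule K M)
    (v : HeightOneSpectrum (𝓞 K)) (d : galoisCohomology ρ 1) :
    galoisCohomology.localization (cd.twist ρ) (Sum.inr v) 1 (galoisCohomology.pullback ρ cd.conj 1 d) =
      cd.transportH1 ρ v (galoisCohomology.localization ρ (Sum.inr (cd.σ • v)) 1 d) := by
  obtain ⟨f, rfl⟩ := oneCocycleClass_surjective ρ.toTopRep d
  -- the global twist as a cocycle of `Tw T`
  have htw : galoisCohomology.pullback ρ cd.conj 1 (oneCocycleClass ρ.toTopRep f) =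
      oneCocycleClass (cd.twist ρ).toTopRep
        (contOneCocycles.pullback cd.conj (X := ρ.toTopRep) (Y := (cd.twist ρ).toTopRep)
          (TopRep.ofHom ⟨ContinuousLinearMap.id ℤ M, fun _ => rfl⟩) f) :=
    galoisCohomology.pullback_one_oneCocycleClass ρ cd.conj f
  -- localizing a class of `X` at a finite place `w`
  have hloc : ∀ (X : DiscreteGaloisModule K M) (w : HeightOneSpectrum (𝓞 K))
      (χ : contOneCocycles X.toTopRep),
      galoisCohomology.localization X (Sum.inr w) 1 (oneCocycleClass _ χ) =
        oneCocycleClass (X.toLocal (Sum.inr w)).toTopRep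
          (contOneCocycles.pullback (absGaloisRestrict K (Place.Completion (Sum.inr w)))
            (X := X.toTopRep) (Y := (X.toLocal (Sum.inr w)).toTopRep)
            (TopRep.ofHom ⟨ContinuousLinearMap.id ℤ M, fun _ => rfl⟩) χ) :=
    fun X w χ => map_oneCocycleClass _ _ _ χ
  rw [htw, hloc, hloc, ConjugationDatum.transportH1_oneCocycleClass]
  refine oneCocycleClass_eq_of_forall_sub_eq _ _ (-(f.1 (cd.δ v))) fun g => ?_
  change f.1 (cd.conj (absGaloisRestrict K (v.adicCompletion K) g)) -
      ρ (cd.δ v) (f.1 (absGaloisRestrict K ((cd.σ • v).adicCompletion K) (cd.φ v g))) =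
    ρ (cd.conj (absGaloisRestrict K (v.adicCompletion K) g)) (-(f.1 (cd.δ v))) - -(f.1 (cd.δ v))
  rw [ConjugationDatum.conj_absGaloisRestrict_eq, cocycle_apply_conj, map_neg]
  abel

end ConjugationDatum

/-! ## §2 Reciprocity + H.4 ⇒ the local term at an inert prime vanishes -/

namespace DualityDatum

variable {R : Type} [CommRing R] [Module R M] [TopologicalSpace R] [DiscreteTopology R]
  {p : ℕ} [Fact p.Prime] [Algebra ℤ_[p] R] {cd : ConjugationDatum K} {ρ : DiscreteGaloisModule K M}
  [Finite M] (D : DualityDatum p cd ρ R) {k : ℕ}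
  (lam : R →+ ZMod (p ^ k))
  (hlam : ∀ (z : ℤ_[p]) (r : R), lam (algebraMap ℤ_[p] R z * r) = PadicInt.toZModPow k z * lam r)
  (exp : ZMod (p ^ k) →+ MuCarrier K (p ^ k))
  (hexp : ∀ (g : absoluteGaloisGroup K) (x : ZMod (p ^ k)),
    exp (cyclotomicCharacterModPow K p k g * x) = mu K (p ^ k) g (exp x))

/-- The local term of the pair `(c, Θ_*(τ^* d))` at a finite place `v`, read in Howard's currency:
`⟨c_v, (Θ τ^* d)_v⟩_{Tate} = H²(exp ∘ λ)(loc_v c ∪_e transport_v (loc_{σ v} d))`.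
[cite: Howard2004HeegnerKolyvagin, §1.3 H.4 (arXiv p. 7 L78–82) and Lemma 1.5.6 (p. 10 L88–91)] -/
theorem localTatePairing_localization_toTateDual_pullback (v : HeightOneSpectrum (𝓞 K))
    (c d : galoisCohomology ρ 1) :
    localTatePairing ρ (p ^ k) (Sum.inr v) (galoisCohomology.localization ρ (Sum.inr v) 1 c)
        (galoisCohomology.localization (ρ.tateDual (p ^ k)) (Sum.inr v) 1
          (galoisCohomology.map (D.toTateDual lam hlam exp hexp) 1
            (galoisCohomology.pullback ρ cd.conj 1 d))) =
      cohomologyMap (D.expLamLocalHom lam hlam exp hexp (Sum.inr v)) 2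
        (D.localCup (Sum.inr v) (galoisCohomology.localization ρ (Sum.inr v) 1 c)
          (cd.transportH1 ρ v (galoisCohomology.localization ρ (Sum.inr (cd.σ • v)) 1 d))) := by
  rw [DiscreteGaloisModule.localization_map_one, ConjugationDatum.localization_pullback_conj,
    D.cohomologyMap_localCup_eq_localTatePairing lam hlam exp hexp]

/-- **Reciprocity + H.4 ⇒ «`⟨c_q, d_q̄⟩_q = 0`» at an inert prime `q`** (Howard, Lemma 1.5.3 (b) /
Lemma 1.5.6 at `m = q`), read through the pair `(λ, exp)`: for `inv` with `∑_v ⟨·,·⟩_v = 0` on global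
classes (`SumLocalTermEqZero`), `𝓕` self-orthogonal under `D` at every finite `v ≠ q` (H.4), and
`c, d` satisfying the local conditions `𝓕_v` at every finite `v ≠ q` (classes of `𝓕` RELAXED at `q`)
with `loc_w c = 0` at the infinite places:
`inv_q (H²(exp ∘ λ) (loc_q c ∪_e transport_q (loc_{σ q} d))) = 0`.
[cite: Howard2004HeegnerKolyvagin, Lemma 1.5.3 (b) (arXiv p. 10 L27–33) and Lemma 1.5.6 (p. 10 L86–93)] [cite: MilneADT2006, Ch. I Thm. 4.10 (reciprocity)] -/
theorem inv_cohomologyMap_localCup_transportH1_eq_zero (hn : ∀ m : M, (p ^ k) • m = 0)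
    (inv : LocalInvariants K (p ^ k)) (hPT : inv.SumLocalTermEqZero)
    (𝓕 : SelmerStructure ρ) {q : HeightOneSpectrum (𝓞 K)} (hq : cd.σ • q = q)
    (horth : ∀ v : HeightOneSpectrum (𝓞 K), v ≠ q → D.IsSelfOrthogonalAt 𝓕 v)
    {c d : galoisCohomology ρ 1}
    (hc : ∀ v : HeightOneSpectrum (𝓞 K), v ≠ q →
      galoisCohomology.localization ρ (Sum.inr v) 1 c ∈ 𝓕 (Sum.inr v))
    (hd : ∀ v : HeightOneSpectrum (𝓞 K), v ≠ q →
      galoisCohomology.localization ρ (Sum.inr v) 1 d ∈ 𝓕 (Sum.inr v))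
    (hinf : ∀ w : InfinitePlace K, galoisCohomology.localization ρ (Sum.inl w) 1 c = 0) :
    inv (Sum.inr q) (cohomologyMap (D.expLamLocalHom lam hlam exp hexp (Sum.inr q)) 2
      (D.localCup (Sum.inr q) (galoisCohomology.localization ρ (Sum.inr q) 1 c)
        (cd.transportH1 ρ q (galoisCohomology.localization ρ (Sum.inr (cd.σ • q)) 1 d)))) = 0 := by
  -- the global partner `y = Θ_*(τ^* d) ∈ H¹(K, T^∨(1))`
  set y : galoisCohomology (ρ.tateDual (p ^ k)) 1 :=
    galoisCohomology.map (D.toTateDual lam hlam exp hexp) 1 (galoisCohomology.pullback ρ cd.conj 1 d)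
    with hy
  -- every local term away from `q` vanishes
  have key : ∀ v : Place K, v ∉ ({Sum.inr q} : Finset (Place K)) → inv.localTerm ρ v c y = 0 := by
    rintro (w | v) hv
    · rw [LocalInvariants.localTerm_apply, hinf w, map_zero, AddMonoidHom.zero_apply, map_zero]
    · have hvq : v ≠ q := fun h => hv (by rw [h, Finset.mem_singleton])
      rw [LocalInvariants.localTerm_apply, hy,
        D.localTatePairing_localization_toTateDual_pullback lam hlam exp hexp v c d]
      have h0 : D.localCup (Sum.inr v) (galoisCohomology.localization ρ (Sum.inr v) 1 c)
          (cd.transportH1 ρ v (galoisCohomology.localization ρ (Sum.inr (cd.σ • v)) 1 d)) = 0 :=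
        ((horth v hvq).1 _).mp (hc v hvq) _ ⟨_, hd (cd.σ • v) (cd.smul_ne_of_ne hq hvq), rfl⟩
      rw [h0]
      exact (congrArg (inv (Sum.inr v)) (map_zero _)).trans (map_zero _)
  have hsum := hPT ρ hn c y {Sum.inr q} key
  rw [Finset.sum_singleton, LocalInvariants.localTerm_apply, hy,
    D.localTatePairing_localization_toTateDual_pullback lam hlam exp hexp q c d] at hsum
  exact hsum

/-- With `inv_q` injective (local Tate duality for the family, `IsPerfect`): **the class
`H²(exp ∘ λ)(loc_q c ∪_e transport_q (loc_{σ q} d))` is zero** in `H²(K_q, μ_{p^k})`.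
[cite: Howard2004HeegnerKolyvagin, Lemma 1.5.3 (b) (arXiv p. 10 L27–33) and Lemma 1.5.6 (p. 10 L86–93)] [cite: MilneADT2006, Ch. I Cor. 2.3, Thm. 4.10] -/
theorem cohomologyMap_localCup_transportH1_eq_zero (hn : ∀ m : M, (p ^ k) • m = 0)
    (inv : LocalInvariants K (p ^ k)) (hPT : inv.SumLocalTermEqZero)
    (𝓕 : SelmerStructure ρ) {q : HeightOneSpectrum (𝓞 K)} (hq : cd.σ • q = q)
    (hinj : Injective (inv (Sum.inr q : Place K)))
    (horth : ∀ v : HeightOneSpectrum (𝓞 K), v ≠ q → D.IsSelfOrthogonalAt 𝓕 v)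
    {c d : galoisCohomology ρ 1}
    (hc : ∀ v : HeightOneSpectrum (𝓞 K), v ≠ q →
      galoisCohomology.localization ρ (Sum.inr v) 1 c ∈ 𝓕 (Sum.inr v))
    (hd : ∀ v : HeightOneSpectrum (𝓞 K), v ≠ q →
      galoisCohomology.localization ρ (Sum.inr v) 1 d ∈ 𝓕 (Sum.inr v))
    (hinf : ∀ w : InfinitePlace K, galoisCohomology.localization ρ (Sum.inl w) 1 c = 0) :
    cohomologyMap (D.expLamLocalHom lam hlam exp hexp (Sum.inr q)) 2
      (D.localCup (Sum.inr q) (galoisCohomology.localization ρ (Sum.inr q) 1 c)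
        (cd.transportH1 ρ q (galoisCohomology.localization ρ (Sum.inr (cd.σ • q)) 1 d))) = 0 :=
  hinj ((D.inv_cohomologyMap_localCup_transportH1_eq_zero lam hlam exp hexp hn inv hPT 𝓕 hq horth
    hc hd hinf).trans (map_zero _).symm)

/-- **Selmer-group form** («for any `c, d ∈ H¹_{𝓕^q}(K, T)`»): if `𝓡` is a Selmer structure agreeing
with the self-orthogonal `𝓕` at every finite place other than the inert `q` (the structure RELAXED
at `q`, or any other modification AT `q` only), then for `c, d ∈ H¹_𝓡(K, T)` the local term at `q`
vanishes: `inv_q (H²(exp ∘ λ)(loc_q c ∪_e transport_q (loc_{σ q} d))) = 0` — «`A ⊂ A^⟂`» for the image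
`A` of `H¹_𝓡(K, T)` in `H¹(K_q, T)`, read through `(λ, exp)`.
[cite: Howard2004HeegnerKolyvagin, Lemma 1.5.6 (arXiv p. 10 L86–93: «which shows that `A ⊂ A^⟂`»)] [cite: MilneADT2006, Ch. I Thm. 4.10] -/
theorem inv_cohomologyMap_localCup_transportH1_eq_zero_of_mem_selmerGroup
    (hn : ∀ m : M, (p ^ k) • m = 0)
    (inv : LocalInvariants K (p ^ k)) (hPT : inv.SumLocalTermEqZero)
    (𝓕 𝓡 : SelmerStructure ρ) {q : HeightOneSpectrum (𝓞 K)} (hq : cd.σ • q = q)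
    (hoff : ∀ v : HeightOneSpectrum (𝓞 K), v ≠ q → 𝓡 (Sum.inr v) = 𝓕 (Sum.inr v))
    (horth : ∀ v : HeightOneSpectrum (𝓞 K), v ≠ q → D.IsSelfOrthogonalAt 𝓕 v)
    (hinf : ∀ (w : InfinitePlace K) (x : galoisCohomology ρ 1),
      galoisCohomology.localization ρ (Sum.inl w) 1 x = 0)
    {c d : galoisCohomology ρ 1} (hc : c ∈ 𝓡.selmerGroup) (hd : d ∈ 𝓡.selmerGroup) :
    inv (Sum.inr q) (cohomologyMap (D.expLamLocalHom lam hlam exp hexp (Sum.inr q)) 2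
      (D.localCup (Sum.inr q) (galoisCohomology.localization ρ (Sum.inr q) 1 c)
        (cd.transportH1 ρ q (galoisCohomology.localization ρ (Sum.inr (cd.σ • q)) 1 d)))) = 0 := by
  rw [SelmerStructure.mem_selmerGroup_iff] at hc hd
  exact D.inv_cohomologyMap_localCup_transportH1_eq_zero lam hlam exp hexp hn inv hPT 𝓕 hq horth
    (fun v hv => hoff v hv ▸ hc (Sum.inr v)) (fun v hv => hoff v hv ▸ hd (Sum.inr v))
    (fun w => hinf w c)


/-! ## §3 The same under the WEAK (isotropy-only) form of H.4

The theorems of §2 assume the full H.4 clause `IsSelfOrthogonalAt` (exact orthogonal complement) at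
`v ≠ q` but USE only its isotropy half «every class of `𝓕_v` annihilates the transport of `𝓕_{σ v}`»
— which is the form in which H.4 descends to the propagated structure on a quotient `T/IT`
(`IsotropyDescentProofs.isotropic_propagateStructure`, e.g. to `T̄` with the residual datum of
`ResidualDualityDatumProofs`). The variants below take that weak form as hypothesis. -/

/-- **Reciprocity + isotropy ⇒ «`⟨c_q, d_q̄⟩_q = 0`»**, weak-hypothesis form of
`inv_cohomologyMap_localCup_transportH1_eq_zero`: at every finite `v ≠ q` it suffices that the
classes of `𝓕_v` annihilate the transport of `𝓕_{σ v}` under `∪_e` (isotropy; no exactness of the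
orthogonal complement). [cite: Howard2004HeegnerKolyvagin, Lemma 1.5.3 (b) (arXiv p. 10 L27–33) and Lemma 1.5.6 (p. 10 L86–93)] [cite: MilneADT2006, Ch. I Thm. 4.10 (reciprocity)] -/
theorem inv_cohomologyMap_localCup_transportH1_eq_zero_of_isotropic (hn : ∀ m : M, (p ^ k) • m = 0)
    (inv : LocalInvariants K (p ^ k)) (hPT : inv.SumLocalTermEqZero)
    (𝓕 : SelmerStructure ρ) {q : HeightOneSpectrum (𝓞 K)} (hq : cd.σ • q = q)
    (hiso : ∀ v : HeightOneSpectrum (𝓞 K), v ≠ q →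
      ∀ x ∈ 𝓕 (Sum.inr v), ∀ y ∈ (𝓕 (Sum.inr (cd.σ • v))).map (cd.transportH1 ρ v),
        D.localCup (Sum.inr v) x y = 0)
    {c d : galoisCohomology ρ 1}
    (hc : ∀ v : HeightOneSpectrum (𝓞 K), v ≠ q →
      galoisCohomology.localization ρ (Sum.inr v) 1 c ∈ 𝓕 (Sum.inr v))
    (hd : ∀ v : HeightOneSpectrum (𝓞 K), v ≠ q →
      galoisCohomology.localization ρ (Sum.inr v) 1 d ∈ 𝓕 (Sum.inr v))
    (hinf : ∀ w : InfinitePlace K, galoisCohomology.localization ρ (Sum.inl w) 1 c = 0) :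
    inv (Sum.inr q) (cohomologyMap (D.expLamLocalHom lam hlam exp hexp (Sum.inr q)) 2
      (D.localCup (Sum.inr q) (galoisCohomology.localization ρ (Sum.inr q) 1 c)
        (cd.transportH1 ρ q (galoisCohomology.localization ρ (Sum.inr (cd.σ • q)) 1 d)))) = 0 := by
  -- the global partner `y = Θ_*(τ^* d) ∈ H¹(K, T^∨(1))`
  set y : galoisCohomology (ρ.tateDual (p ^ k)) 1 :=
    galoisCohomology.map (D.toTateDual lam hlam exp hexp) 1 (galoisCohomology.pullback ρ cd.conj 1 d)
    with hy
  have key : ∀ v : Place K, v ∉ ({Sum.inr q} : Finset (Place K)) → inv.localTerm ρ v c y = 0 := by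
    rintro (w | v) hv
    · rw [LocalInvariants.localTerm_apply, hinf w, map_zero, AddMonoidHom.zero_apply, map_zero]
    · have hvq : v ≠ q := fun h => hv (by rw [h, Finset.mem_singleton])
      rw [LocalInvariants.localTerm_apply, hy,
        D.localTatePairing_localization_toTateDual_pullback lam hlam exp hexp v c d]
      have h0 : D.localCup (Sum.inr v) (galoisCohomology.localization ρ (Sum.inr v) 1 c)
          (cd.transportH1 ρ v (galoisCohomology.localization ρ (Sum.inr (cd.σ • v)) 1 d)) = 0 :=
        hiso v hvq _ (hc v hvq) _ ⟨_, hd (cd.σ • v) (cd.smul_ne_of_ne hq hvq), rfl⟩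
      rw [h0]
      exact (congrArg (inv (Sum.inr v)) (map_zero _)).trans (map_zero _)
  have hsum := hPT ρ hn c y {Sum.inr q} key
  rw [Finset.sum_singleton, LocalInvariants.localTerm_apply, hy,
    D.localTatePairing_localization_toTateDual_pullback lam hlam exp hexp q c d] at hsum
  exact hsum

/-- With `inv_q` injective, weak-hypothesis form: the class
`H²(exp ∘ λ)(loc_q c ∪_e transport_q (loc_{σ q} d))` is zero.
[cite: Howard2004HeegnerKolyvagin, Lemma 1.5.3 (b) (arXiv p. 10 L27–33) and Lemma 1.5.6 (p. 10 L86–93)] [cite: MilneADT2006, Ch. I Cor. 2.3, Thm. 4.10] -/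
theorem cohomologyMap_localCup_transportH1_eq_zero_of_isotropic (hn : ∀ m : M, (p ^ k) • m = 0)
    (inv : LocalInvariants K (p ^ k)) (hPT : inv.SumLocalTermEqZero)
    (𝓕 : SelmerStructure ρ) {q : HeightOneSpectrum (𝓞 K)} (hq : cd.σ • q = q)
    (hinj : Injective (inv (Sum.inr q : Place K)))
    (hiso : ∀ v : HeightOneSpectrum (𝓞 K), v ≠ q →
      ∀ x ∈ 𝓕 (Sum.inr v), ∀ y ∈ (𝓕 (Sum.inr (cd.σ • v))).map (cd.transportH1 ρ v),
        D.localCup (Sum.inr v) x y = 0)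
    {c d : galoisCohomology ρ 1}
    (hc : ∀ v : HeightOneSpectrum (𝓞 K), v ≠ q →
      galoisCohomology.localization ρ (Sum.inr v) 1 c ∈ 𝓕 (Sum.inr v))
    (hd : ∀ v : HeightOneSpectrum (𝓞 K), v ≠ q →
      galoisCohomology.localization ρ (Sum.inr v) 1 d ∈ 𝓕 (Sum.inr v))
    (hinf : ∀ w : InfinitePlace K, galoisCohomology.localization ρ (Sum.inl w) 1 c = 0) :
    cohomologyMap (D.expLamLocalHom lam hlam exp hexp (Sum.inr q)) 2
      (D.localCup (Sum.inr q) (galoisCohomology.localization ρ (Sum.inr q) 1 c)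
        (cd.transportH1 ρ q (galoisCohomology.localization ρ (Sum.inr (cd.σ • q)) 1 d))) = 0 :=
  hinj ((D.inv_cohomologyMap_localCup_transportH1_eq_zero_of_isotropic lam hlam exp hexp hn inv hPT 𝓕
    hq hiso hc hd hinf).trans (map_zero _).symm)

/-- **Selmer-group form, weak hypothesis**: for `𝓡` agreeing with the isotropic `𝓕` off the inert
`q`, and `c, d ∈ H¹_𝓡(K, T)`: `inv_q (H²(exp ∘ λ)(loc_q c ∪_e transport_q (loc_{σ q} d))) = 0`
(«`A ⊂ A^⟂`» read through `(λ, exp)`). With `IsotropyDescentProofs` and `ResidualDualityDatumProofs`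
this runs on `T̄`. [cite: Howard2004HeegnerKolyvagin, Lemma 1.5.6 (arXiv p. 10 L86–93: «which shows that `A ⊂ A^⟂`»)] [cite: MilneADT2006, Ch. I Thm. 4.10] -/
theorem inv_cohomologyMap_localCup_transportH1_eq_zero_of_isotropic_of_mem_selmerGroup
    (hn : ∀ m : M, (p ^ k) • m = 0)
    (inv : LocalInvariants K (p ^ k)) (hPT : inv.SumLocalTermEqZero)
    (𝓕 𝓡 : SelmerStructure ρ) {q : HeightOneSpectrum (𝓞 K)} (hq : cd.σ • q = q)
    (hoff : ∀ v : HeightOneSpectrum (𝓞 K), v ≠ q → 𝓡 (Sum.inr v) = 𝓕 (Sum.inr v))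
    (hiso : ∀ v : HeightOneSpectrum (𝓞 K), v ≠ q →
      ∀ x ∈ 𝓕 (Sum.inr v), ∀ y ∈ (𝓕 (Sum.inr (cd.σ • v))).map (cd.transportH1 ρ v),
        D.localCup (Sum.inr v) x y = 0)
    (hinf : ∀ (w : InfinitePlace K) (x : galoisCohomology ρ 1),
      galoisCohomology.localization ρ (Sum.inl w) 1 x = 0)
    {c d : galoisCohomology ρ 1} (hc : c ∈ 𝓡.selmerGroup) (hd : d ∈ 𝓡.selmerGroup) :
    inv (Sum.inr q) (cohomologyMap (D.expLamLocalHom lam hlam exp hexp (Sum.inr q)) 2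
      (D.localCup (Sum.inr q) (galoisCohomology.localization ρ (Sum.inr q) 1 c)
        (cd.transportH1 ρ q (galoisCohomology.localization ρ (Sum.inr (cd.σ • q)) 1 d)))) = 0 := by
  rw [SelmerStructure.mem_selmerGroup_iff] at hc hd
  exact D.inv_cohomologyMap_localCup_transportH1_eq_zero_of_isotropic lam hlam exp hexp hn inv hPT 𝓕
    hq hiso (fun v hv => hoff v hv ▸ hc (Sum.inr v)) (fun v hv => hoff v hv ▸ hd (Sum.inr v))
    (fun w => hinf w c)

end DualityDatum

end Literature.NumberTheory.GaloisCohomology.Howard2004
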